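import Summits.BirchSwinnertonDyer.Rank1Residual.X11a.PrintDischargeHeegner
import Summits.BirchSwinnertonDyer.Rank1Residual.X11a.VisibilityRecordsNoRam
import Summits.BirchSwinnertonDyer.Rank1Residual.X11a.ChaRecords1
import Summits.BirchSwinnertonDyer.Rank1Residual.X11a.ChaRecords2
import HarnessLib

/-!
# Class X11a, NON-surjective leaf (`5S4`, non-split at `5`): per-pair FLAG-FREE Heegner-index closures,
# file 1 of 4 — `51840bf1`, `184960co1`, `230640f1` (cell `bsd-print-x11a`, seat ty3 g9)

HONEST FRAMING (cells `b2b-bsdres` / `bsd-print-x11a`, verbatim): the goal is to DELETE the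
COMBINATION-SHAPED residual classes of the Birch–Swinnerton-Dyer formula for ALL analytic-rank `≤ 1`
elliptic curves over `ℚ`; BSD is NOT proved by any of this; every theorem below is CONDITIONAL on its
displayed hypotheses; PER PAIR (E1 currency), never a class theorem; nothing here moves a PARTITION label.

WHAT. Twelve NON-SPLIT `5S4` pairs of the non-surjective X11a leaf have `5 ∤ ∏ c_ℓ · #Ш_an · #E(ℚ)_tors`
(`N < 5·10⁵`); for nine of them the cell's certificate seat ty3 holds a two-engine HEEGNER-INDEX certificate
(`Literature/…/X11aPrintCertificates/RecordsLeafNonSurjHeegner{,Part2}.lean`, p545224/p546189, schema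
`ClaimHeegner.lean`: Heegner field `K = ℚ(√D)`, Heegner point `y_K` of level `N` of infinite order,
`ord₅ [E(K) : ℤ y_K] = 0`, engines Sage/GJPST and PARI/Miller agreeing; cell referee ENGINE-R 16/16), and for
the other three (`51840bd1`, `115320m1`, `317520cp1`) the same two-engine pipeline ran this generation (ty3 g9, kit
j309823, 4/4 CERT incl. the calibration row → `RecordsLeafNonSurjHeegnerPart3.lean`). In referee A's census book
(`pub/pub-bsdpct`, state R1049, 2026-08-28) every one of these twelve classes is RESIDUE with `(5, X11a)` its
ONLY open cell. The earlier per-pair records (`X11a/ChaRecords1–3.lean`, `Theorems/PrintX11aUnitValueRecords*`)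
key the closing fact to the WIDE registered `Cha2005.thm52_padicValNat_shaOrder_le` (register flag R-24) or to
the thirteen γ-keyed Kato facts (counting flag R-48) and were never offered (cell referee R2-1: «re-point through
the `_discr` doors before any pair is booked»). This file gives, per pair, the class atoms IN THE KERNEL and two
FLAG-FREE closures through seat ty2's discharge interface (`X11a/PrintDischargeHeegner.lean`, p543869):

* `classX11a_h<label> : W = ⟨a⟩ → W.analyticRank = 0 → ClassX11a W 5` — KERNEL: `5 ∥ N` via `5 ∣ Δ ∧ 5 ∤ c₄`
  on the integral model (Silverman VII.5.1 (b)); `E[5]` irreducible by a Frobenius witness `ℓ`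
  (`#Ẽ(𝔽_ℓ)` = the tree's `card_*<label>_ℓ`, `X² − a_ℓX + ℓ` root-free mod `5`; Mazur 1978 Prop. 6.3 (1));
  no (ram) prime (`VisibilityRecords.not_ram_of_intModel`: every `ℓ ∣ Δ` is `5`, additive, or has `5 ∣ ord_ℓ Δ`).
* `bsdp5_mn<label>` — `BSD(E,5)` from **Matar–Nekovář 2019 Thm. 6.7 (1)** (`hMN`, tree fact
  `MatarNekovar2019.thm67_sha_primary_trivial_of_irreducible N W K`; `E[p]` irreducible only, no `d_K`-clause,
  no surjectivity) + GZK (`hGZK`), door `ClassX11a.bsdp_of_matarNekovarCertificate`.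
* `bsdp5_ch<label>` — `BSD(E,5)` from **Cha 2005 Thm. 21, print-exact** (`hCha`, tree fact
  `Cha2005.thm52_padicValNat_shaOrder_le_discr`; = GJPST 2009 Thm. 3.5 + Prop. 3.1 = Miller 2011 Thm. 5.2)
  + GZK, door `ClassX11a.bsdp_of_chaCertificate'`; `d_K ∉ {−3, −4}` DERIVED from `2 ∣ N` or `3 ∣ N`
  (`discr_ne_of_two_dvd_level` / `discr_ne_of_three_dvd_level`), `5 ∤ d_K` inside the door from `5 ∣ N`.

DISPLAYED per pair (sockets = exactly the data of the ty3 certificate row): the level `N` (`[NeZero N]`,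
`5 ∣ N`; for Cha also `5² ∤ N` and `2 ∣ N` resp. `3 ∣ N` — read `N = N_E`), `K` imaginary quadratic with the
Heegner hypothesis for `N` (`hK hH`), the Heegner point `P = y_K` of level `N` (`hP`) of infinite order (`hnt`)
with `5 ∤ [E(K) : ℤP]` (`hI`, torsion included), `r_an = 0` (`hr`), `#Ш_an = q` a `5`-adic unit (`hq hv`).
Facts: `hMN` resp. `hCha`, and `hGZK`. Kernel: `Δ ≠ 0`, minimality (tree `isGloballyMinimal_*<label>` of
`X11a/ChaRecords1–2.lean`), the class atoms. Grammar = p4's `X11a/VisibilityRecordsAtoms*` (`classX11a_c`) + p3/p4's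
`X11a/ChaRecords*` (`bsdp5_c`), re-keyed to the flag-free doors.

| pair | model | `N` | `∏c`·`#Ш_an` | cert: `D`, `h_K`, index, `ord₅` | Frobenius witness |
|---|---|---|---|---|---|
| `51840bf1` | `[0, 0, 0, -153, 1098]` | `2⁷·3⁴·5` | 1·1 | `-671`, 30, 2, 0 | `ℓ = 11`, `#Ẽ = 8` |
| `184960co1` | `[0, 1, 0, -160491, 24953309]` | `2⁷·5·17²` | 2·4 | `-319`, 10, 8, 0 | `ℓ = 7`, `#Ẽ = 3` |
| `230640f1` | `[0, -1, 0, -196, 5371]` | `2⁴·3·5·31²` | 1·1 | `-1751`, 48, 1, 0 | `ℓ = 11`, `#Ẽ = 18` |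

Beyond-print theorem: NO. Theorems only (no `def`, no named fact, no `sorry`, no instance/notation).

References: [MatarNekovar2019] Thm. 6.7 (1) (p. 498), §6.1 (p. 497); [Cha2005] Thm. 21 (p. 173), §5.1;
[GrigorovJorzaPatrikisSteinTarnita2009] Def. 3.2, Prop. 3.1 (p. 2404), Thm. 3.5 (p. 2405); [Miller2011LMS] Def. 1.1,
Thm. 5.2; [Mazur1978] §6 Prop. 6.3 (1) (p. 153); [SilvermanAEC2009] VII.5 Prop. 5.1; [Cremona2006] Table 1;
tree `X11a/PrintDischargeHeegner.lean`, `X11a/VisibilityRecordsNoRam.lean`, `X11a/ChaRecords1–2.lean`,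
`X11aPrintCertificates/RecordsLeafNonSurjHeegner{,Part2}.lean`; cell doc
`pub/bsd-print-x11a/TY3-CERTIFICATE-RECORDS.md` §6 and §16.
-/

set_option autoImplicit false

noncomputable section

open scoped Classical

open WeierstrassCurve Literature.NumberTheory.EllipticCurves
  Literature.NumberTheory.EllipticCurves.Rank1Residual
  Literature.NumberTheory.EllipticCurves.Rank1Residual.Typed
  Literature.NumberTheory.EllipticCurves.Cha2005
  NumberField IsDedekindDomain Rat.HeightOneSpectrum
  Summit.BirchSwinnertonDyer.BirchSwinnertonDyer.Rank1Residual.IntModel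
  Summit.BirchSwinnertonDyer.Rank1Residual.X11a.VisibilityRecords

namespace Summit.BirchSwinnertonDyer.Rank1Residual.X11a.HeegnerClosures

/-! ### `51840bf1 @ 5` (`N = 51840 = 2⁷·3⁴·5`, image `5S4`, non-split at `5`, `∏ c_ℓ = 1`, `#Ш_an = 1`, `#E(ℚ)_tors = 1`) -/

/-- **`51840bf1 = [0, 0, 0, -153, 1098]` lies in class X11a at `5`, in the KERNEL up to `r_an = 0`**:
`5 ∥ N` (`5 ∣ Δ = ±2⁷·3⁶·5⁵`, `5 ∤ c₄`; Silverman VII.5.1 (b)); `E[5]` irreducible by the Frobenius witness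
`ℓ = 11` (`#Ẽ(𝔽_11) = 8`, `a_11 = 4`, `X² − a_11X + 11` root-free mod `5`; tree `ChaRecords.card_c51840bf1_11`;
Mazur 1978 Prop. 6.3 (1)); no (ram) prime (`2` additive, `3` additive, `5 = p`). Displayed: `hr` (`r_an = 0`, Cremona).
[cite: SilvermanAEC2009, VII.5 Prop. 5.1] [cite: Mazur1978, §6 Prop. 6.3 (1) (p. 153)]
[cite: Cremona2006, Table 1 (Cremona label 51840bf1)] -/
theorem classX11a_h51840bf1 (W : WeierstrassCurve ℚ) [W.IsElliptic] [W.IsGloballyMinimal] [Fact (Nat.Prime 5)]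
    (hWeq : W = ⟨0, 0, 0, -153, 1098⟩) (hr : W.analyticRank = 0) : ClassX11a W 5 := by
  haveI : Fact (Nat.Prime 2) := ⟨Nat.prime_two⟩
  haveI : Fact (Nat.Prime 3) := ⟨Nat.prime_three⟩
  haveI : Fact (Nat.Prime 11) := ⟨by norm_num⟩
  have hI : integralModelInt W = ⟨0, 0, 0, -153, 1098⟩ := by
    subst hWeq; exact integralModelInt_eq_of_map_eq _ (map_mk_int 0 0 0 (-153) 1098)
  have hmult : Mult W 5 :=
    hasMultiplicativeReductionAtPrime_of_intModel hI 5 (by decide +kernel) (by decide +kernel)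
  have hirr : Irr W 5 :=
    hasIrreducibleModPGaloisRep_of_intModel_of_noroot (hp := ⟨by norm_num⟩) (hℓ := ⟨by norm_num⟩)
      hI 5 11 (by norm_num) (by decide +kernel) ChaRecords.card_c51840bf1_11 (by decide)
  have hnram : ¬ Ram W 5 := not_ram_of_intModel hI 5 [2, 3, 5] [7, 6, 5]
    (by intro q hq; simp only [List.mem_cons, List.mem_nil_iff, or_false] at hq
        rcases hq with rfl | rfl | rfl <;> norm_num) (by decide +kernel)
    (by intro ℓ hℓ; simp only [List.mem_cons, List.mem_nil_iff, or_false] at hℓ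
        rcases hℓ with rfl | rfl | rfl
        · exact Or.inr (Or.inl (by decide +kernel))
        · exact Or.inr (Or.inl (by decide +kernel))
        · exact Or.inl rfl)
  exact ⟨hr, by decide, hmult, hirr, hnram⟩

/-- **`BSD(E,5)` for `51840bf1` from Matar–Nekovář 2019 Thm. 6.7 (1) + GZK, the Heegner-index certificate
displayed** (`K` with the Heegner hypothesis for the level `N`, `y_K = P` of level `N` of infinite order,
`5 ∤ [E(K) : ℤ y_K]`; ty3 row: `D = -671`, `h_K = 30`, index `2`, `ord₅ = 0`), `r_an = 0`, `#Ш_an` a `5`-adic unit. KERNEL: `Δ ≠ 0`,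
minimality (`ChaRecords.isGloballyMinimal_c51840bf1`), the class atoms (`classX11a_h51840bf1`). Flag-free; PER PAIR; nothing booked by this file.
[cite: MatarNekovar2019, Thm. 6.7 (1) (p. 498) and §6.1 (p. 497)] [cite: Miller2011LMS, §1 and Def. 1.1]
[cite: Cremona2006, Table 1 (Cremona label 51840bf1)] -/
theorem bsdp5_mn51840bf1 (hGZK : rank_eq_analyticRank_of_analyticRank_le_one)
    (W : WeierstrassCurve ℚ) (hW : W = ⟨0, 0, 0, -153, 1098⟩) (hr : W.analyticRank = 0)
    {N : ℕ} [NeZero N] {K : Type} [Field K] [NumberField K]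
    (hMN : MatarNekovar2019.thm67_sha_primary_trivial_of_irreducible N W K)
    (hK : IsImaginaryQuadratic K) (hH : SatisfiesHeegnerHypothesis N K)
    {P : (W.baseChange K).toAffine.Point} (hP : IsHeegnerPoint N W K P) (hnt : ¬ IsOfFinAddOrder P)
    (hpN₁ : 5 ∣ N) (hI : ¬ 5 ∣ (AddSubgroup.zmultiples P).index)
    {q : ℚ} (hq : shaAn W = (q : ℂ)) (hv : padicValRat 5 q = 0) : BSDp W 5 := by
  haveI : W.IsElliptic := by
    rw [hW]; exact X11b.isElliptic_of_discOf_ne_zero 0 0 0 (-153) 1098 (by decide +kernel)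
  haveI : W.IsGloballyMinimal := by rw [hW]; exact ChaRecords.isGloballyMinimal_c51840bf1
  haveI : Fact (Nat.Prime 5) := ⟨by norm_num⟩
  exact (classX11a_h51840bf1 W hW hr).bsdp_of_matarNekovarCertificate hMN hGZK hK hH hP hnt hpN₁ hI hq hv

/-- **`BSD(E,5)` for `51840bf1` from Cha 2005 Thm. 21 (print-exact fact `Cha2005.thm52_padicValNat_shaOrder_le_discr`)
+ GZK and the same certificate**; the field clauses `d_K ∉ {−3, −4}` are derived from `2 ∣ N`
(`discr_ne_of_two_dvd_level`), `5 ∤ d_K` inside the door from `5 ∣ N`. Flag-free; PER PAIR; nothing booked by this file.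
[cite: Cha2005, Thm. 21 (p. 173) and §5.1] [cite: GrigorovJorzaPatrikisSteinTarnita2009, Thm. 3.5 and Prop. 3.1 (pp. 2404–2405)]
[cite: Miller2011LMS, Thm. 5.2 and Def. 1.1] [cite: Cremona2006, Table 1 (Cremona label 51840bf1)] -/
theorem bsdp5_ch51840bf1 (hCha : thm52_padicValNat_shaOrder_le_discr)
    (hGZK : rank_eq_analyticRank_of_analyticRank_le_one)
    (W : WeierstrassCurve ℚ) (hW : W = ⟨0, 0, 0, -153, 1098⟩) (hr : W.analyticRank = 0)
    {N : ℕ} [NeZero N] {K : Type} [Field K] [NumberField K]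
    (hK : IsImaginaryQuadratic K) (hH : SatisfiesHeegnerHypothesis N K)
    {P : (W.baseChange K).toAffine.Point} (hP : IsHeegnerPoint N W K P) (hnt : ¬ IsOfFinAddOrder P)
    (h2N : 2 ∣ N) (hpN : ¬ 5 ^ 2 ∣ N) (hpN₁ : 5 ∣ N) (hI : ¬ 5 ∣ (AddSubgroup.zmultiples P).index)
    {q : ℚ} (hq : shaAn W = (q : ℂ)) (hv : padicValRat 5 q = 0) : BSDp W 5 := by
  haveI : W.IsElliptic := by
    rw [hW]; exact X11b.isElliptic_of_discOf_ne_zero 0 0 0 (-153) 1098 (by decide +kernel)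
  haveI : W.IsGloballyMinimal := by rw [hW]; exact ChaRecords.isGloballyMinimal_c51840bf1
  haveI : Fact (Nat.Prime 5) := ⟨by norm_num⟩
  have hD := discr_ne_of_two_dvd_level hK hH h2N
  exact (classX11a_h51840bf1 W hW hr).bsdp_of_chaCertificate' hCha hGZK hK hH hP hnt hD.1 hD.2 hpN hpN₁
    hI hq hv

/-! ### `184960co1 @ 5` (`N = 184960 = 2⁷·5·17²`, image `5S4`, non-split at `5`, `∏ c_ℓ = 2`, `#Ш_an = 4`, `#E(ℚ)_tors = 1`) -/

/-- **`184960co1 = [0, 1, 0, -160491, 24953309]` lies in class X11a at `5`, in the KERNEL up to `r_an = 0`**: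
`5 ∥ N` (`5 ∣ Δ = ±2⁸·5⁵·17⁸`, `5 ∤ c₄`; Silverman VII.5.1 (b)); `E[5]` irreducible by the Frobenius witness
`ℓ = 7` (`#Ẽ(𝔽_7) = 3`, `a_7 = 5`, `X² − a_7X + 7` root-free mod `5`; tree `ChaRecords.card_c184960co1_7`;
Mazur 1978 Prop. 6.3 (1)); no (ram) prime (`2` additive, `5 = p`, `17` additive). Displayed: `hr` (`r_an = 0`, Cremona).
[cite: SilvermanAEC2009, VII.5 Prop. 5.1] [cite: Mazur1978, §6 Prop. 6.3 (1) (p. 153)]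
[cite: Cremona2006, Table 1 (Cremona label 184960co1)] -/
theorem classX11a_h184960co1 (W : WeierstrassCurve ℚ) [W.IsElliptic] [W.IsGloballyMinimal] [Fact (Nat.Prime 5)]
    (hWeq : W = ⟨0, 1, 0, -160491, 24953309⟩) (hr : W.analyticRank = 0) : ClassX11a W 5 := by
  haveI : Fact (Nat.Prime 2) := ⟨Nat.prime_two⟩
  haveI : Fact (Nat.Prime 3) := ⟨Nat.prime_three⟩
  haveI : Fact (Nat.Prime 7) := ⟨by norm_num⟩
  haveI : Fact (Nat.Prime 17) := ⟨by norm_num⟩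
  have hI : integralModelInt W = ⟨0, 1, 0, -160491, 24953309⟩ := by
    subst hWeq; exact integralModelInt_eq_of_map_eq _ (map_mk_int 0 1 0 (-160491) 24953309)
  have hmult : Mult W 5 :=
    hasMultiplicativeReductionAtPrime_of_intModel hI 5 (by decide +kernel) (by decide +kernel)
  have hirr : Irr W 5 :=
    hasIrreducibleModPGaloisRep_of_intModel_of_noroot (hp := ⟨by norm_num⟩) (hℓ := ⟨by norm_num⟩)
      hI 5 7 (by norm_num) (by decide +kernel) ChaRecords.card_c184960co1_7 (by decide)
  have hnram : ¬ Ram W 5 := not_ram_of_intModel hI 5 [2, 5, 17] [8, 5, 8]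
    (by intro q hq; simp only [List.mem_cons, List.mem_nil_iff, or_false] at hq
        rcases hq with rfl | rfl | rfl <;> norm_num) (by decide +kernel)
    (by intro ℓ hℓ; simp only [List.mem_cons, List.mem_nil_iff, or_false] at hℓ
        rcases hℓ with rfl | rfl | rfl
        · exact Or.inr (Or.inl (by decide +kernel))
        · exact Or.inl rfl
        · exact Or.inr (Or.inl (by decide +kernel)))
  exact ⟨hr, by decide, hmult, hirr, hnram⟩

/-- **`BSD(E,5)` for `184960co1` from Matar–Nekovář 2019 Thm. 6.7 (1) + GZK, the Heegner-index certificate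
displayed** (`K` with the Heegner hypothesis for the level `N`, `y_K = P` of level `N` of infinite order,
`5 ∤ [E(K) : ℤ y_K]`; ty3 row: `D = -319`, `h_K = 10`, index `8`, `ord₅ = 0`), `r_an = 0`, `#Ш_an` a `5`-adic unit. KERNEL: `Δ ≠ 0`,
minimality (`ChaRecords.isGloballyMinimal_c184960co1`), the class atoms (`classX11a_h184960co1`). Flag-free; PER PAIR; nothing booked by this file.
[cite: MatarNekovar2019, Thm. 6.7 (1) (p. 498) and §6.1 (p. 497)] [cite: Miller2011LMS, §1 and Def. 1.1]
[cite: Cremona2006, Table 1 (Cremona label 184960co1)] -/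
theorem bsdp5_mn184960co1 (hGZK : rank_eq_analyticRank_of_analyticRank_le_one)
    (W : WeierstrassCurve ℚ) (hW : W = ⟨0, 1, 0, -160491, 24953309⟩) (hr : W.analyticRank = 0)
    {N : ℕ} [NeZero N] {K : Type} [Field K] [NumberField K]
    (hMN : MatarNekovar2019.thm67_sha_primary_trivial_of_irreducible N W K)
    (hK : IsImaginaryQuadratic K) (hH : SatisfiesHeegnerHypothesis N K)
    {P : (W.baseChange K).toAffine.Point} (hP : IsHeegnerPoint N W K P) (hnt : ¬ IsOfFinAddOrder P)
    (hpN₁ : 5 ∣ N) (hI : ¬ 5 ∣ (AddSubgroup.zmultiples P).index)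
    {q : ℚ} (hq : shaAn W = (q : ℂ)) (hv : padicValRat 5 q = 0) : BSDp W 5 := by
  haveI : W.IsElliptic := by
    rw [hW]; exact X11b.isElliptic_of_discOf_ne_zero 0 1 0 (-160491) 24953309 (by decide +kernel)
  haveI : W.IsGloballyMinimal := by rw [hW]; exact ChaRecords.isGloballyMinimal_c184960co1
  haveI : Fact (Nat.Prime 5) := ⟨by norm_num⟩
  exact (classX11a_h184960co1 W hW hr).bsdp_of_matarNekovarCertificate hMN hGZK hK hH hP hnt hpN₁ hI hq hv

/-- **`BSD(E,5)` for `184960co1` from Cha 2005 Thm. 21 (print-exact fact `Cha2005.thm52_padicValNat_shaOrder_le_discr`)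
+ GZK and the same certificate**; the field clauses `d_K ∉ {−3, −4}` are derived from `2 ∣ N`
(`discr_ne_of_two_dvd_level`), `5 ∤ d_K` inside the door from `5 ∣ N`. Flag-free; PER PAIR; nothing booked by this file.
[cite: Cha2005, Thm. 21 (p. 173) and §5.1] [cite: GrigorovJorzaPatrikisSteinTarnita2009, Thm. 3.5 and Prop. 3.1 (pp. 2404–2405)]
[cite: Miller2011LMS, Thm. 5.2 and Def. 1.1] [cite: Cremona2006, Table 1 (Cremona label 184960co1)] -/
theorem bsdp5_ch184960co1 (hCha : thm52_padicValNat_shaOrder_le_discr)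
    (hGZK : rank_eq_analyticRank_of_analyticRank_le_one)
    (W : WeierstrassCurve ℚ) (hW : W = ⟨0, 1, 0, -160491, 24953309⟩) (hr : W.analyticRank = 0)
    {N : ℕ} [NeZero N] {K : Type} [Field K] [NumberField K]
    (hK : IsImaginaryQuadratic K) (hH : SatisfiesHeegnerHypothesis N K)
    {P : (W.baseChange K).toAffine.Point} (hP : IsHeegnerPoint N W K P) (hnt : ¬ IsOfFinAddOrder P)
    (h2N : 2 ∣ N) (hpN : ¬ 5 ^ 2 ∣ N) (hpN₁ : 5 ∣ N) (hI : ¬ 5 ∣ (AddSubgroup.zmultiples P).index)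
    {q : ℚ} (hq : shaAn W = (q : ℂ)) (hv : padicValRat 5 q = 0) : BSDp W 5 := by
  haveI : W.IsElliptic := by
    rw [hW]; exact X11b.isElliptic_of_discOf_ne_zero 0 1 0 (-160491) 24953309 (by decide +kernel)
  haveI : W.IsGloballyMinimal := by rw [hW]; exact ChaRecords.isGloballyMinimal_c184960co1
  haveI : Fact (Nat.Prime 5) := ⟨by norm_num⟩
  have hD := discr_ne_of_two_dvd_level hK hH h2N
  exact (classX11a_h184960co1 W hW hr).bsdp_of_chaCertificate' hCha hGZK hK hH hP hnt hD.1 hD.2 hpN hpN₁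
    hI hq hv

/-! ### `230640f1 @ 5` (`N = 230640 = 2⁴·3·5·31²`, image `5S4`, non-split at `5`, `∏ c_ℓ = 1`, `#Ш_an = 1`, `#E(ℚ)_tors = 1`) -/

/-- **`230640f1 = [0, -1, 0, -196, 5371]` lies in class X11a at `5`, in the KERNEL up to `r_an = 0`**:
`5 ∥ N` (`5 ∣ Δ = ±2⁴·3⁵·5⁵·31²`, `5 ∤ c₄`; Silverman VII.5.1 (b)); `E[5]` irreducible by the Frobenius witness
`ℓ = 11` (`#Ẽ(𝔽_11) = 18`, `a_11 = -6`, `X² − a_11X + 11` root-free mod `5`; tree `ChaRecords.card_c230640f1_11`;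
Mazur 1978 Prop. 6.3 (1)); no (ram) prime (`2` additive, `3` multiplicative with `ord_3 Δ = 5`, `5 ∣ 5`, `5 = p`, `31` additive). Displayed: `hr` (`r_an = 0`, Cremona).
[cite: SilvermanAEC2009, VII.5 Prop. 5.1] [cite: Mazur1978, §6 Prop. 6.3 (1) (p. 153)]
[cite: Cremona2006, Table 1 (Cremona label 230640f1)] -/
theorem classX11a_h230640f1 (W : WeierstrassCurve ℚ) [W.IsElliptic] [W.IsGloballyMinimal] [Fact (Nat.Prime 5)]
    (hWeq : W = ⟨0, -1, 0, -196, 5371⟩) (hr : W.analyticRank = 0) : ClassX11a W 5 := by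
  haveI : Fact (Nat.Prime 2) := ⟨Nat.prime_two⟩
  haveI : Fact (Nat.Prime 3) := ⟨Nat.prime_three⟩
  haveI : Fact (Nat.Prime 11) := ⟨by norm_num⟩
  haveI : Fact (Nat.Prime 31) := ⟨by norm_num⟩
  have hI : integralModelInt W = ⟨0, -1, 0, -196, 5371⟩ := by
    subst hWeq; exact integralModelInt_eq_of_map_eq _ (map_mk_int 0 (-1) 0 (-196) 5371)
  have hmult : Mult W 5 :=
    hasMultiplicativeReductionAtPrime_of_intModel hI 5 (by decide +kernel) (by decide +kernel)
  have hirr : Irr W 5 :=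
    hasIrreducibleModPGaloisRep_of_intModel_of_noroot (hp := ⟨by norm_num⟩) (hℓ := ⟨by norm_num⟩)
      hI 5 11 (by norm_num) (by decide +kernel) ChaRecords.card_c230640f1_11 (by decide)
  have hnram : ¬ Ram W 5 := not_ram_of_intModel hI 5 [2, 3, 5, 31] [4, 5, 5, 2]
    (by intro q hq; simp only [List.mem_cons, List.mem_nil_iff, or_false] at hq
        rcases hq with rfl | rfl | rfl | rfl <;> norm_num) (by decide +kernel)
    (by intro ℓ hℓ; simp only [List.mem_cons, List.mem_nil_iff, or_false] at hℓ
        rcases hℓ with rfl | rfl | rfl | rfl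
        · exact Or.inr (Or.inl (by decide +kernel))
        · have hv : padicValInt 3 (⟨0, -1, 0, -196, 5371⟩ : WeierstrassCurve ℤ).Δ = 5 :=
            padicValInt_eq_of_dvd_of_not_dvd 3 (by decide +kernel) (by decide +kernel)
          exact Or.inr (Or.inr (Int.natCast_dvd_natCast.mpr (Dvd.intro 1 (by omega))))
        · exact Or.inl rfl
        · exact Or.inr (Or.inl (by decide +kernel)))
  exact ⟨hr, by decide, hmult, hirr, hnram⟩

/-- **`BSD(E,5)` for `230640f1` from Matar–Nekovář 2019 Thm. 6.7 (1) + GZK, the Heegner-index certificate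
displayed** (`K` with the Heegner hypothesis for the level `N`, `y_K = P` of level `N` of infinite order,
`5 ∤ [E(K) : ℤ y_K]`; ty3 row: `D = -1751`, `h_K = 48`, index `1`, `ord₅ = 0`), `r_an = 0`, `#Ш_an` a `5`-adic unit. KERNEL: `Δ ≠ 0`,
minimality (`ChaRecords.isGloballyMinimal_c230640f1`), the class atoms (`classX11a_h230640f1`). Flag-free; PER PAIR; nothing booked by this file.
[cite: MatarNekovar2019, Thm. 6.7 (1) (p. 498) and §6.1 (p. 497)] [cite: Miller2011LMS, §1 and Def. 1.1]
[cite: Cremona2006, Table 1 (Cremona label 230640f1)] -/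
theorem bsdp5_mn230640f1 (hGZK : rank_eq_analyticRank_of_analyticRank_le_one)
    (W : WeierstrassCurve ℚ) (hW : W = ⟨0, -1, 0, -196, 5371⟩) (hr : W.analyticRank = 0)
    {N : ℕ} [NeZero N] {K : Type} [Field K] [NumberField K]
    (hMN : MatarNekovar2019.thm67_sha_primary_trivial_of_irreducible N W K)
    (hK : IsImaginaryQuadratic K) (hH : SatisfiesHeegnerHypothesis N K)
    {P : (W.baseChange K).toAffine.Point} (hP : IsHeegnerPoint N W K P) (hnt : ¬ IsOfFinAddOrder P)
    (hpN₁ : 5 ∣ N) (hI : ¬ 5 ∣ (AddSubgroup.zmultiples P).index)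
    {q : ℚ} (hq : shaAn W = (q : ℂ)) (hv : padicValRat 5 q = 0) : BSDp W 5 := by
  haveI : W.IsElliptic := by
    rw [hW]; exact X11b.isElliptic_of_discOf_ne_zero 0 (-1) 0 (-196) 5371 (by decide +kernel)
  haveI : W.IsGloballyMinimal := by rw [hW]; exact ChaRecords.isGloballyMinimal_c230640f1
  haveI : Fact (Nat.Prime 5) := ⟨by norm_num⟩
  exact (classX11a_h230640f1 W hW hr).bsdp_of_matarNekovarCertificate hMN hGZK hK hH hP hnt hpN₁ hI hq hv

/-- **`BSD(E,5)` for `230640f1` from Cha 2005 Thm. 21 (print-exact fact `Cha2005.thm52_padicValNat_shaOrder_le_discr`)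
+ GZK and the same certificate**; the field clauses `d_K ∉ {−3, −4}` are derived from `2 ∣ N`
(`discr_ne_of_two_dvd_level`), `5 ∤ d_K` inside the door from `5 ∣ N`. Flag-free; PER PAIR; nothing booked by this file.
[cite: Cha2005, Thm. 21 (p. 173) and §5.1] [cite: GrigorovJorzaPatrikisSteinTarnita2009, Thm. 3.5 and Prop. 3.1 (pp. 2404–2405)]
[cite: Miller2011LMS, Thm. 5.2 and Def. 1.1] [cite: Cremona2006, Table 1 (Cremona label 230640f1)] -/
theorem bsdp5_ch230640f1 (hCha : thm52_padicValNat_shaOrder_le_discr)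
    (hGZK : rank_eq_analyticRank_of_analyticRank_le_one)
    (W : WeierstrassCurve ℚ) (hW : W = ⟨0, -1, 0, -196, 5371⟩) (hr : W.analyticRank = 0)
    {N : ℕ} [NeZero N] {K : Type} [Field K] [NumberField K]
    (hK : IsImaginaryQuadratic K) (hH : SatisfiesHeegnerHypothesis N K)
    {P : (W.baseChange K).toAffine.Point} (hP : IsHeegnerPoint N W K P) (hnt : ¬ IsOfFinAddOrder P)
    (h2N : 2 ∣ N) (hpN : ¬ 5 ^ 2 ∣ N) (hpN₁ : 5 ∣ N) (hI : ¬ 5 ∣ (AddSubgroup.zmultiples P).index)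
    {q : ℚ} (hq : shaAn W = (q : ℂ)) (hv : padicValRat 5 q = 0) : BSDp W 5 := by
  haveI : W.IsElliptic := by
    rw [hW]; exact X11b.isElliptic_of_discOf_ne_zero 0 (-1) 0 (-196) 5371 (by decide +kernel)
  haveI : W.IsGloballyMinimal := by rw [hW]; exact ChaRecords.isGloballyMinimal_c230640f1
  haveI : Fact (Nat.Prime 5) := ⟨by norm_num⟩
  have hD := discr_ne_of_two_dvd_level hK hH h2N
  exact (classX11a_h230640f1 W hW hr).bsdp_of_chaCertificate' hCha hGZK hK hH hP hnt hD.1 hD.2 hpN hpN₁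
    hI hq hv

end Summit.BirchSwinnertonDyer.Rank1Residual.X11a.HeegnerClosures

end
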